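import Summits.QuantumFields.BalabanUV.T4Continuum.Spine.NE1p.DressedSmallFieldOnCoresMass
import Summits.QuantumFields.BalabanUV.T4Continuum.Spine.NE1p.DressedSmallFieldOnCoresFaces

/-!
# T⁴ programme, spine estimate NE1′ (node O3b/H2) — THE LETTER-BUDGET SMALL-FIELD ENDs OF N0q WITHOUT A RADIUS BINDER AND WITHOUT A
# GEOMETRY HYPOTHESIS: the ϱ-free print-clause form of the (B3)-as-letters pencil END over a `B13Resummation.Geometry` (N0m §4∕§4b BY
# NAME, sharp room 3), the TORUS forms of N0q's four ENDs at pv22's `tgeometry 4 N`, and the S27 ∘ N0q commuting check (crew FACE row)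

Cell `pub-balaban`, sub-cell `t4`, BINDER-OWNERS row NE1′ (owner lineage t4-ne1p-p1); crew seat `b2b-balaban-t4-ne1p-formalise-leaf-03`
(LEAF PROVER 03; INTENT at generation 10, filed at generation 11); crew FACE row S28 (DAG N29zo) on INTENT `CLAIMS.log`
2026-08-20T16:19:20Z, BOOKED by the NE1′ typer R-T113 (iii-a) (the S24∕S25∕S26∕S27 pattern for the owner's gen-28 module N0q).
ADDITIVE — imports the owner's N0q `Spine/NE1p/DressedSmallFieldOnCoresMass` (p226475; ⇒ N0p `DressedSmallFieldOnCores` ⇒ N0o ⇒ N0m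
v1.2; row NE5's `OutputRateOpGaussianParam` ∕ `B13TermParamGaussianBiProd`) and crew row S27 `Spine/NE1p/DressedSmallFieldOnCoresFaces`
(p225562; ⇒ S26 ⇒ S24 for `K₀_four`; for `attachedPart_locE_le_of_cores_pencil_torus`) ONLY; THEOREMS ONLY (+ one `example`; 0 `def`,
0 `def … : Prop`); nothing of N0q ∕ N0p ∕ N0o ∕ N0m ∕ S24–S27 ∕ row NE5 restated.

WHY THIS FILE.  N0q re-reads N0p's (B3) binder `hL3` — the (2.38)-shape of the cores' parameter-mass INTEGRALS — as `hM3`, the same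
shape on the cores' SCALAR LETTERS `λ(univ)·(wB·N₀·e^{bq})·(π∕(mq∕2))^{dim∕2}·e^{N₁R₀}` (row NE5's `paramMass` currency), and adds the
μ-part on cores; every N0q END keeps (i) a `G : B13Resummation.Geometry` with the clauses at `G`'s letters and (ii) (attached ENDs)
N0m's radius conditions `hϱ`∕`hϱA`.  After S24–S27 every other small-field END has a geometry-free torus form and (attached ENDs) a
ϱ-free form.  THIS FILE wires the same for N0q, nothing else:
* §1 over ONE `G : Geometry D Cube`: `attachedPart_locE_le_of_cores_pencil_mass_printClause_three` — N0q `attachedPart_locE_le_of_cores_pencil_mass`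
  ONCE BY NAME at `ϱ⋆ := max 2 (A₀/A₁)` with `hϱ` ∕ `hϱA` ∕ `hsmall` SUPPLIED by N0m's `two_le_pencilRadius` ∕ `intercept_le_pencilRadius_mul` ∕
  `pencilClause_of_printClause_three` under `0 < A₁ ≤ A₀` and `h3 : 3·A₀·(e^{b₅+1}·G.K₀·G.ν·G.c₁) ≤ 1`; `hM3`, `hH`, `hact` READ AT `ϱ⋆`.
* §2 at `tgeometry 4 N` (pv22; `D := tsys 4 N`), constants LOCATED AS NUMERALS (N0o `torus_consts` + S24 `K₀_four`; `b₅ = 5·r₁` through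
  N0q's `hb`): `attachedPart_locE_le_of_cores_pencil_mass_torus`, `attachedPart_locE_le_of_cores_pencil_mass_printClause_three_torus`,
  `muPart_locE_le_of_cores_torus`, `muPart_locE_le_of_cores_mass_torus` — NO geometry hypothesis; `hM3`∕`hL3` against `torusTreeLen`;
  conclusions LITERALLY the W24∕S25∕S26∕S27 currency `4 * (Real.exp 1 * 9 * 64 * K₀ 64 8 ^ 2) * A₁ * Real.exp (-(r₁ * torusTreeLen X₀.1))`
  and the μ-part currency.
* §3 one `example` — THE COMMUTING SQUARE in kernel: §2's `…_pencil_mass_torus` statement re-derived through S27's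
  `attachedPart_locE_le_of_cores_pencil_torus` with `hL3` fed from `hM3` by N0q §2 `sum_coreMass_le_sum_letters` BY NAME — (N0p → N0q →
  torus) = (N0p → S27 → letters); NO new inequality.
WHAT STAYS DISPLAYED (binders, by name; NOTHING instantiated on Bałaban's densities): operator letters `hm`∕`hN`∕`hq` and room `hroom`
(rows NE2∕NE3's Gaussian data, row NE5's binders verbatim); the pencil inside the class (`hO`∕`hH`, or `hcurve`∕`hK`∕`hR` for the source
pencil); placement `hscale` and INDEXING `hact` ((B1)'s bookkeeping half); (B3) AS A LETTER BUDGET `hM3` (resp. `hL3` for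
`muPart_locE_le_of_cores_torus`) — ONE scalar (2.38)-SHAPE inequality per polymer among the cores' LETTERS (G-ne9p2-5, UNPRINTED, shared
with NE9; a BINDER, never `[cite:`-tagged; (2.38)'s decay must come from `wB·N₀` — the (2.15) cube-letter mechanism, cf. W34); `hA₀`,
`hA₁` (`0 < A₁ ≤ A₀` for the ϱ-free forms), `hr₁`, the window `0 < μ₀ < μ₁`, and the located clauses «κ large» `r₁ + 2·(64·log 162) + 2 ≤ R`
and «ε₁ small» in the SHAPES `(A₀ + ϱA₁)·E ≤ 1` ∕ `3·A₀·E ≤ 1` ∕ `A·E ≤ 1`, `E = e^{5r₁+1}·K₀(64,8)·9·64` ((B5): the factor `3` is the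
owner's arithmetic BY NAME; `π`, `2`, `finrank` are the Gaussian mass's letters (N0q), no numeral of print).  (B4) is discharged BY NAME on
pv22's CONSTRUCTED torus geometry; the identification of `tsys 4 N` ∕ `torusTreeLen` with Bałaban's 𝐃_{k+1} ∕ d_{k+1} is pv22's READING
(DIVERGENCE D-pv22.3), not asserted here — statements about typed SHAPES; no wall item moves; wall v1.6 does NOT move; R-t4r2-Q2 NOT met.
HONEST FRAMING.  Kernel bookkeeping over SHAPES — faces re-socketing the owner's N0q ENDs BY NAME; (B3) = G-ne9p2-5 reads as ONE scalar
(2.38)-shape inequality per polymer among the cores' LETTERS — row NE5's `paramMass` currency; nothing of (B3) discharged; 0 binders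
instantiated on Bałaban's densities; no new inequality; wall v1.6 does NOT move; R-t4r2-Q2 NOT met thereby; NE1′ NOT proved.  Printed
loci ([Balaban1988RGII] (2.14)∕(2.15) p. 15, (2.18) p. 16, (1.26) p. 8, (2.27) ∕ (2.30) p. 18, (2.38) p. 20, p. 21; [Balaban1987RGI] p. 251,
p. 257) are TYPE ∕ CONTEXT through the imported [cite]-tagged Literature modules, re-asserted nowhere; ABSOLUTE RULE honoured
([folklore] kernel lemmas only).  NE1′ ⇐ the named binders — NOT printed, NOT proved; 0 leaves instantiated on Bałaban's densities;
spine PROVED 0∕9; count 9 unchanged.  Rung (B)+1 on ONE finite four-torus — NOT infinite volume, NOT a mass gap, NOT OS on ℝ⁴, NOT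
Clay.  HONEST DEPENDENCY: continuum YM on T⁴ ⇐ BetaPertH ∧ nine spine estimates (0/9 proved); BetaPertH ⇐ (D1) ∧ (D4) ∧ CAP+tail;
G-an2-4 gates asym, D1 and NE2/3/4.
-/
noncomputable section

namespace Summit.QuantumFields.BalabanUV.T4Continuum.NE1p.DressedSmallFieldOnCoresMassFaces

open Metric Set Complex MeasureTheory
open scoped BigOperators
open Literature.MathematicalPhysics.QuantumFieldTheory.Balaban1983to89 (LocDomainSys)
open Literature.MathematicalPhysics.QuantumFieldTheory.Balaban1983to89.T4OutputRate (Carriers)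
open Literature.MathematicalPhysics.QuantumFieldTheory.Balaban1983to89.B13Resummation (locE Geometry)
open Literature.MathematicalPhysics.QuantumFieldTheory.Balaban1983to89.T4InputCauchyRateSpecies (ballClass)
open Literature.MathematicalPhysics.QuantumFieldTheory.Balaban1983to89.TreeLengthTorus (tsys torusTreeLen)
open Literature.MathematicalPhysics.QuantumFieldTheory.Balaban1983to89.TreeLengthTorusGeometry (TTouch tgeometry)
open Literature.MathematicalPhysics.QuantumFieldTheory.Balaban1983to89.B12TreeDecay (K₀ K₀_pos)
open Summit.QuantumFields.BalabanUV.T4Continuum.B13HistMeasurable (MeasPotFrame B13HistM)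
open Summit.QuantumFields.BalabanUV.T4Continuum.B13TermParamGaussianBi (BiCore termBi)
open Summit.QuantumFields.BalabanUV.T4Continuum.NE1p.DressedSmallFieldOnCoresMass (sum_coreMass_le_sum_letters
  attachedPart_locE_le_of_cores_pencil_mass muPart_locE_le_of_cores muPart_locE_le_of_cores_mass)
open Summit.QuantumFields.BalabanUV.T4Continuum.NE1p.DressedSmallFieldOnCoresFaces (attachedPart_locE_le_of_cores_pencil_torus)
open Summit.QuantumFields.BalabanUV.T4Continuum.NE1p.DressedSmallFieldInduction (two_le_pencilRadius
  intercept_le_pencilRadius_mul pencilClause_of_printClause_three)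
open Summit.QuantumFields.BalabanUV.T4Continuum.NE1p.DressedSmallFieldGeometry (torus_consts)
open Summit.QuantumFields.BalabanUV.T4Continuum.NE1p.DressedSmallFieldGeometryFaces (K₀_four)

variable {C : Carriers} {P : MeasPotFrame C} {𝒴 : Type*} {dom : 𝒴 → C.Dom} {Op : Type*} [NormedAddCommGroup Op]
  [NormedSpace ℂ Op] {ι : Type*} {β : ℕ → ι → Type*} [∀ k i, MeasurableSpace (β k i)] {α : ℕ → ι → Type*}
  [∀ k i, NormedAddCommGroup (α k i)] [∀ k i, InnerProductSpace ℝ (α k i)] [∀ k i, FiniteDimensional ℝ (α k i)]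
  [∀ k i, MeasurableSpace (α k i)] [∀ k i, BorelSpace (α k i)]

/-! ## §1 THE ϱ-FREE FORM OF THE LETTER-BUDGET PENCIL END OVER A `B13Resummation.Geometry` — N0m §4∕§4b BY NAME (sharp room 3) -/

section OfGeometry

variable (D : LocDomainSys) {Cube : Type} [DecidableEq Cube] (G : Geometry D Cube)

open Classical in
/-- **THE LETTER-BUDGET PENCIL END UNDER PRINT'S CLAUSE WITH THE SHARP FACTOR-3 ROOM — NO RADIUS BINDER** (kernel; N0q §2
`attachedPart_locE_le_of_cores_pencil_mass` ONCE BY NAME at the pencil radius `ϱ⋆ := max 2 (A₀/A₁)`, its `hϱ` ∕ `hϱA` ∕ `hsmall`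
SUPPLIED by N0m's `two_le_pencilRadius` ∕ `intercept_le_pencilRadius_mul` ∕ `pencilClause_of_printClause_three` BY NAME): live slope
`0 < A₁ ≤ A₀`, «κ large» `hrate`, «ε₁ small at the UNDRESSED constant, sharp room 3» `h3 : 3·A₀·(e^{b₅+1}·G.K₀·G.ν·G.c₁) ≤ 1`; the
remaining binders are N0q's verbatim — operator letters `hm`∕`hN`∕`hq`, room `hroom`, the two pencil radius inequalities `hO` and
`hH` READ AT `ϱ⋆`, placement `hscale`, indexing `hact` on the disc of radius `ϱ⋆`, and (B3) AS A LETTER BUDGET `hM3` at the affine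
constant `A₀ + ϱ⋆·A₁` with the growth `e^{N₁·(‖h₀‖ + ϱ⋆‖w‖)}` — conclusion `≤ 4·(e·G.ν·G.c₁·G.K₀²)·A₁·e^{−r₁ d(X₀)}`. [folklore] -/
theorem attachedPart_locE_le_of_cores_pencil_mass_printClause_three {W : Set (ℕ → ℝ)}
    {ctr : ℕ → (ℕ → ℝ) → C.BgB → Op × B13HistM P} {ROp RHist R' : ℕ → ℝ}
    (𝔊 : ∀ k i, C.Dom → BiCore P dom Op (β k i) (α k i)) {mq bq N₀ : ℕ → ι → C.Dom → ℝ} (hroom : ∀ k, ROp k < R' k)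
    (hm : ∀ k, ∀ g ∈ W, ∀ (U : C.BgB) (X : C.Dom), C.scale X = k → ∀ i, 0 < mq k i X)
    (hN : ∀ k, ∀ g ∈ W, ∀ (U : C.BgB) (X : C.Dom), C.scale X = k → ∀ i,
      (∀ o ∈ ball (ctr k g U).1 (R' k), AEStronglyMeasurable ((𝔊 k i X).N o) (𝔊 k i X).lam) ∧
      (∀ p, DifferentiableOn ℂ (fun o => (𝔊 k i X).N o p) (ball (ctr k g U).1 (R' k))) ∧
      (∀ o ∈ ball (ctr k g U).1 (R' k), ∀ p, ‖(𝔊 k i X).N o p‖ ≤ N₀ k i X))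
    (hq : ∀ k, ∀ g ∈ W, ∀ (U : C.BgB) (X : C.Dom), C.scale X = k → ∀ i,
      (∀ o ∈ ball (ctr k g U).1 (R' k),
        AEStronglyMeasurable (Function.uncurry ((𝔊 k i X).q o)) ((𝔊 k i X).lam.prod volume)) ∧
      (∀ p v, DifferentiableOn ℂ (fun o => (𝔊 k i X).q o p v) (ball (ctr k g U).1 (R' k))) ∧
      (∀ o ∈ ball (ctr k g U).1 (R' k), ∀ p v, mq k i X * ‖v‖ ^ 2 - bq k i X ≤ ((𝔊 k i X).q o p v).re))
    {k : ℕ} {g : ℕ → ℝ} (hg : g ∈ W) {U : C.BgB} {o : Op} {h₀ w : B13HistM P} {A₀ A₁ : ℝ}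
    (hO : ‖o - (ctr k g U).1‖ ≤ ROp k) (hH : ‖h₀ - (ctr k g U).2‖ + max 2 (A₀ / A₁) * ‖w‖ ≤ RHist k)
    {emb : D.Dom → C.Dom} (hscale : ∀ Z, C.scale (emb Z) = k) {terms : D.Dom → Finset ι} {act : ℂ → D.Dom → ℂ}
    (hact : ∀ s ∈ ball (0 : ℂ) (max 2 (A₀ / A₁)), ∀ Z, act s Z = ∑ i ∈ terms Z, termBi 𝔊 k i o (h₀ + s • w) (emb Z))
    {R r₁ b₅ : ℝ} {X₀ : D.Dom} (hA₀ : 0 ≤ A₀) (hA₁ : 0 < A₁) (hle : A₁ ≤ A₀) (hr₁ : 0 ≤ r₁) (hb : r₁ * 5 ≤ b₅)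
    (hrate : r₁ + 2 * G.κ₀ + 2 ≤ R) (h3 : 3 * A₀ * (Real.exp (b₅ + 1) * G.K₀ * G.ν * G.c₁) ≤ 1)
    (hM3 : ∀ Z, G.cubes Z ⊆ G.cubes X₀ →
      ∑ i ∈ terms Z, (𝔊 k i (emb Z)).lam.real univ * ((𝔊 k i (emb Z)).wB * N₀ k i (emb Z) *
          Real.exp (bq k i (emb Z))) * (Real.pi / (mq k i (emb Z) / 2)) ^ (Module.finrank ℝ (α k i) / 2 : ℝ) *
        Real.exp ((𝔊 k i (emb Z)).N₁ * (‖h₀‖ + max 2 (A₀ / A₁) * ‖w‖)) ≤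
          (A₀ + max 2 (A₀ / A₁) * A₁) * Real.exp (-(R * D.dj Z))) :
    ‖locE G.ι G.cubes (act 1) (G.cubes X₀) - locE G.ι G.cubes (act 0) (G.cubes X₀)‖ ≤
      4 * (Real.exp 1 * G.ν * G.c₁ * G.K₀ ^ 2) * A₁ * Real.exp (-(r₁ * D.dj X₀)) := by
  have hE : 0 ≤ Real.exp (b₅ + 1) * G.K₀ * G.ν * G.c₁ :=
    mul_nonneg (mul_nonneg (mul_nonneg (Real.exp_nonneg _) G.K₀_nonneg) G.ν_nonneg) G.c₁_nonneg
  have hsmall : (A₀ + max 2 (A₀ / A₁) * A₁) * Real.exp (b₅ + 1) * G.K₀ * G.ν * G.c₁ ≤ 1 := by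
    simpa only [mul_assoc] using pencilClause_of_printClause_three hA₁ hle hE h3
  exact attachedPart_locE_le_of_cores_pencil_mass D G 𝔊 hroom hm hN hq hg hO hH hscale hact hA₀ hA₁.le hr₁ hb hrate hsmall
    hM3 (two_le_pencilRadius A₀ A₁) (intercept_le_pencilRadius_mul hA₁)

end OfGeometry

/-! ## §2 ON THE TORUS OF THE PAPERS (pv22's `tgeometry 4 N`): NO geometry hypothesis, clauses LOCATED AS NUMERALS (S24–S27 §2
pattern: ν = 9, κ₀ = 64·log 162, c₁ = 64, K₀ = `B12TreeDecay.K₀ 64 8`, print's (2.27) `c = 5`, `b₅ = 5·r₁`) -/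

section Torus

variable {N : ℕ} [NeZero N]

open Classical in
/-- **THE LETTER-BUDGET PENCIL END ON THE TORUS — NO GEOMETRY HYPOTHESIS** (kernel; N0q §2 `attachedPart_locE_le_of_cores_pencil_mass`
at `D := tsys 4 N`, `G := tgeometry 4 N`, constants located by N0o `torus_consts` + S24 `K₀_four`): cores of the format of record with
operator letters `hm`∕`hN`∕`hq` and room `hroom`, pencil `h₀ + s•w` with the two radius inequalities, indexing `hact`, located clauses,
N0m's `2 ≤ ϱ`, `A₀ ≤ ϱA₁`, and (B3) AS A LETTER BUDGET `hM3` against `torusTreeLen`: the attached part on a torus domain `X₀` is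
`≤ 4·(e·9·64·K₀(64,8)²)·A₁·e^{−r₁·torusTreeLen X₀}` — S27's `attachedPart_locE_le_of_cores_pencil_torus` currency. [folklore] -/
theorem attachedPart_locE_le_of_cores_pencil_mass_torus {W : Set (ℕ → ℝ)}
    {ctr : ℕ → (ℕ → ℝ) → C.BgB → Op × B13HistM P} {ROp RHist R' : ℕ → ℝ}
    (𝔊 : ∀ k i, C.Dom → BiCore P dom Op (β k i) (α k i)) {mq bq N₀ : ℕ → ι → C.Dom → ℝ} (hroom : ∀ k, ROp k < R' k)
    (hm : ∀ k, ∀ g ∈ W, ∀ (U : C.BgB) (X : C.Dom), C.scale X = k → ∀ i, 0 < mq k i X)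
    (hN : ∀ k, ∀ g ∈ W, ∀ (U : C.BgB) (X : C.Dom), C.scale X = k → ∀ i,
      (∀ o ∈ ball (ctr k g U).1 (R' k), AEStronglyMeasurable ((𝔊 k i X).N o) (𝔊 k i X).lam) ∧
      (∀ p, DifferentiableOn ℂ (fun o => (𝔊 k i X).N o p) (ball (ctr k g U).1 (R' k))) ∧
      (∀ o ∈ ball (ctr k g U).1 (R' k), ∀ p, ‖(𝔊 k i X).N o p‖ ≤ N₀ k i X))
    (hq : ∀ k, ∀ g ∈ W, ∀ (U : C.BgB) (X : C.Dom), C.scale X = k → ∀ i,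
      (∀ o ∈ ball (ctr k g U).1 (R' k),
        AEStronglyMeasurable (Function.uncurry ((𝔊 k i X).q o)) ((𝔊 k i X).lam.prod volume)) ∧
      (∀ p v, DifferentiableOn ℂ (fun o => (𝔊 k i X).q o p v) (ball (ctr k g U).1 (R' k))) ∧
      (∀ o ∈ ball (ctr k g U).1 (R' k), ∀ p v, mq k i X * ‖v‖ ^ 2 - bq k i X ≤ ((𝔊 k i X).q o p v).re))
    {k : ℕ} {g : ℕ → ℝ} (hg : g ∈ W) {U : C.BgB} {o : Op} {h₀ w : B13HistM P} {ϱ : ℝ}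
    (hO : ‖o - (ctr k g U).1‖ ≤ ROp k) (hH : ‖h₀ - (ctr k g U).2‖ + ϱ * ‖w‖ ≤ RHist k)
    {emb : (tsys 4 N).Dom → C.Dom} (hscale : ∀ Z, C.scale (emb Z) = k) {terms : (tsys 4 N).Dom → Finset ι}
    {act : ℂ → (tsys 4 N).Dom → ℂ}
    (hact : ∀ s ∈ ball (0 : ℂ) ϱ, ∀ Z, act s Z = ∑ i ∈ terms Z, termBi 𝔊 k i o (h₀ + s • w) (emb Z))
    {A₀ A₁ R r₁ : ℝ} (X₀ : (tsys 4 N).Dom) (hA₀ : 0 ≤ A₀) (hA₁ : 0 ≤ A₁) (hr₁ : 0 ≤ r₁)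
    (hrate : r₁ + 2 * (64 * Real.log 162) + 2 ≤ R)
    (hsmall : (A₀ + ϱ * A₁) * Real.exp (5 * r₁ + 1) * K₀ 64 8 * 9 * 64 ≤ 1)
    (hM3 : ∀ Z : (tsys 4 N).Dom, Z.1 ⊆ X₀.1 →
      ∑ i ∈ terms Z, (𝔊 k i (emb Z)).lam.real univ * ((𝔊 k i (emb Z)).wB * N₀ k i (emb Z) *
          Real.exp (bq k i (emb Z))) * (Real.pi / (mq k i (emb Z) / 2)) ^ (Module.finrank ℝ (α k i) / 2 : ℝ) *
        Real.exp ((𝔊 k i (emb Z)).N₁ * (‖h₀‖ + ϱ * ‖w‖)) ≤ (A₀ + ϱ * A₁) * Real.exp (-(R * torusTreeLen Z.1)))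
    (hϱ : 2 ≤ ϱ) (hϱA : A₀ ≤ ϱ * A₁) :
    ‖locE (TTouch (d := 4) (N := N)) (fun Z : (tsys 4 N).Dom => Z.1) (act 1) X₀.1 -
        locE (TTouch (d := 4) (N := N)) (fun Z : (tsys 4 N).Dom => Z.1) (act 0) X₀.1‖ ≤
      4 * (Real.exp 1 * 9 * 64 * K₀ 64 8 ^ 2) * A₁ * Real.exp (-(r₁ * torusTreeLen X₀.1)) := by
  obtain ⟨hν, hκ, hc⟩ := torus_consts N
  have hK₀ := K₀_four (N := N)
  have h := attachedPart_locE_le_of_cores_pencil_mass (tsys 4 N) (tgeometry 4 N) 𝔊 hroom hm hN hq hg hO hH hscale hact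
    (R := R) (b₅ := 5 * r₁) (X₀ := X₀) hA₀ hA₁ hr₁ (le_of_eq (by ring)) (by rw [hκ]; exact hrate)
    (by rw [hK₀, hν, hc]; exact hsmall) hM3 hϱ hϱA
  rw [hν, hc, hK₀] at h
  exact h

open Classical in
/-- **THE LETTER-BUDGET PENCIL END ON THE TORUS, ϱ-FREE — NO GEOMETRY HYPOTHESIS, NO RADIUS BINDER** (kernel; §1 at
`tgeometry 4 N`, constants located): live slope `0 < A₁ ≤ A₀`, «κ large» `r₁ + 2·(64·log 162) + 2 ≤ R`, «ε₁ small, sharp room 3»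
`3·A₀·(e^{5r₁+1}·K₀(64,8)·9·64) ≤ 1`, pencil data and `hM3` READ AT `ϱ⋆ = max 2 (A₀/A₁)` ⇒ the same located bound. [folklore] -/
theorem attachedPart_locE_le_of_cores_pencil_mass_printClause_three_torus {W : Set (ℕ → ℝ)}
    {ctr : ℕ → (ℕ → ℝ) → C.BgB → Op × B13HistM P} {ROp RHist R' : ℕ → ℝ}
    (𝔊 : ∀ k i, C.Dom → BiCore P dom Op (β k i) (α k i)) {mq bq N₀ : ℕ → ι → C.Dom → ℝ} (hroom : ∀ k, ROp k < R' k)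
    (hm : ∀ k, ∀ g ∈ W, ∀ (U : C.BgB) (X : C.Dom), C.scale X = k → ∀ i, 0 < mq k i X)
    (hN : ∀ k, ∀ g ∈ W, ∀ (U : C.BgB) (X : C.Dom), C.scale X = k → ∀ i,
      (∀ o ∈ ball (ctr k g U).1 (R' k), AEStronglyMeasurable ((𝔊 k i X).N o) (𝔊 k i X).lam) ∧
      (∀ p, DifferentiableOn ℂ (fun o => (𝔊 k i X).N o p) (ball (ctr k g U).1 (R' k))) ∧
      (∀ o ∈ ball (ctr k g U).1 (R' k), ∀ p, ‖(𝔊 k i X).N o p‖ ≤ N₀ k i X))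
    (hq : ∀ k, ∀ g ∈ W, ∀ (U : C.BgB) (X : C.Dom), C.scale X = k → ∀ i,
      (∀ o ∈ ball (ctr k g U).1 (R' k),
        AEStronglyMeasurable (Function.uncurry ((𝔊 k i X).q o)) ((𝔊 k i X).lam.prod volume)) ∧
      (∀ p v, DifferentiableOn ℂ (fun o => (𝔊 k i X).q o p v) (ball (ctr k g U).1 (R' k))) ∧
      (∀ o ∈ ball (ctr k g U).1 (R' k), ∀ p v, mq k i X * ‖v‖ ^ 2 - bq k i X ≤ ((𝔊 k i X).q o p v).re))
    {k : ℕ} {g : ℕ → ℝ} (hg : g ∈ W) {U : C.BgB} {o : Op} {h₀ w : B13HistM P} {A₀ A₁ : ℝ}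
    (hO : ‖o - (ctr k g U).1‖ ≤ ROp k) (hH : ‖h₀ - (ctr k g U).2‖ + max 2 (A₀ / A₁) * ‖w‖ ≤ RHist k)
    {emb : (tsys 4 N).Dom → C.Dom} (hscale : ∀ Z, C.scale (emb Z) = k) {terms : (tsys 4 N).Dom → Finset ι}
    {act : ℂ → (tsys 4 N).Dom → ℂ}
    (hact : ∀ s ∈ ball (0 : ℂ) (max 2 (A₀ / A₁)), ∀ Z, act s Z = ∑ i ∈ terms Z, termBi 𝔊 k i o (h₀ + s • w) (emb Z))
    {R r₁ : ℝ} (X₀ : (tsys 4 N).Dom) (hA₀ : 0 ≤ A₀) (hA₁ : 0 < A₁) (hle : A₁ ≤ A₀) (hr₁ : 0 ≤ r₁)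
    (hrate : r₁ + 2 * (64 * Real.log 162) + 2 ≤ R) (h3 : 3 * A₀ * (Real.exp (5 * r₁ + 1) * K₀ 64 8 * 9 * 64) ≤ 1)
    (hM3 : ∀ Z : (tsys 4 N).Dom, Z.1 ⊆ X₀.1 →
      ∑ i ∈ terms Z, (𝔊 k i (emb Z)).lam.real univ * ((𝔊 k i (emb Z)).wB * N₀ k i (emb Z) *
          Real.exp (bq k i (emb Z))) * (Real.pi / (mq k i (emb Z) / 2)) ^ (Module.finrank ℝ (α k i) / 2 : ℝ) *
        Real.exp ((𝔊 k i (emb Z)).N₁ * (‖h₀‖ + max 2 (A₀ / A₁) * ‖w‖)) ≤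
          (A₀ + max 2 (A₀ / A₁) * A₁) * Real.exp (-(R * torusTreeLen Z.1))) :
    ‖locE (TTouch (d := 4) (N := N)) (fun Z : (tsys 4 N).Dom => Z.1) (act 1) X₀.1 -
        locE (TTouch (d := 4) (N := N)) (fun Z : (tsys 4 N).Dom => Z.1) (act 0) X₀.1‖ ≤
      4 * (Real.exp 1 * 9 * 64 * K₀ 64 8 ^ 2) * A₁ * Real.exp (-(r₁ * torusTreeLen X₀.1)) := by
  obtain ⟨hν, hκ, hc⟩ := torus_consts N
  have hK₀ := K₀_four (N := N)
  have h := attachedPart_locE_le_of_cores_pencil_mass_printClause_three (tsys 4 N) (tgeometry 4 N) 𝔊 hroom hm hN hq hg hO hH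
    hscale hact (R := R) (b₅ := 5 * r₁) (X₀ := X₀) hA₀ hA₁ hle hr₁ (le_of_eq (by ring)) (by rw [hκ]; exact hrate)
    (by rw [hK₀, hν, hc]; exact h3) hM3
  rw [hν, hc, hK₀] at h
  exact h

open Classical in
/-- **THE μ-PART ON CORES ON THE TORUS — NO GEOMETRY HYPOTHESIS** (kernel; N0q §3 `muPart_locE_le_of_cores` at `tgeometry 4 N`,
constants located): along a SOURCE pencil `‖s‖ < μ₁` inside the ball class, for `0 < μ₀ < μ₁`, `‖sμ‖ ≤ μ₀`, with (B3) `hL3` on the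
parameter-mass integrals at the constant `A`: the μ-part is `≤ e·9·64·K₀(64,8)²·A·e^{−r₁·torusTreeLen X₀}·μ₀/(μ₁ − μ₀)` — S27's
`muPart_locE_le_of_expLinear_torus` currency, now for cores. [folklore] -/
theorem muPart_locE_le_of_cores_torus {W : Set (ℕ → ℝ)} {ctr : ℕ → (ℕ → ℝ) → C.BgB → Op × B13HistM P}
    {ROp RHist R' : ℕ → ℝ} (𝔊 : ∀ k i, C.Dom → BiCore P dom Op (β k i) (α k i)) {mq bq N₀ : ℕ → ι → C.Dom → ℝ}
    (hroom : ∀ k, ROp k < R' k)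
    (hm : ∀ k, ∀ g ∈ W, ∀ (U : C.BgB) (X : C.Dom), C.scale X = k → ∀ i, 0 < mq k i X)
    (hN : ∀ k, ∀ g ∈ W, ∀ (U : C.BgB) (X : C.Dom), C.scale X = k → ∀ i,
      (∀ o ∈ ball (ctr k g U).1 (R' k), AEStronglyMeasurable ((𝔊 k i X).N o) (𝔊 k i X).lam) ∧
      (∀ p, DifferentiableOn ℂ (fun o => (𝔊 k i X).N o p) (ball (ctr k g U).1 (R' k))) ∧
      (∀ o ∈ ball (ctr k g U).1 (R' k), ∀ p, ‖(𝔊 k i X).N o p‖ ≤ N₀ k i X))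
    (hq : ∀ k, ∀ g ∈ W, ∀ (U : C.BgB) (X : C.Dom), C.scale X = k → ∀ i,
      (∀ o ∈ ball (ctr k g U).1 (R' k),
        AEStronglyMeasurable (Function.uncurry ((𝔊 k i X).q o)) ((𝔊 k i X).lam.prod volume)) ∧
      (∀ p v, DifferentiableOn ℂ (fun o => (𝔊 k i X).q o p v) (ball (ctr k g U).1 (R' k))) ∧
      (∀ o ∈ ball (ctr k g U).1 (R' k), ∀ p v, mq k i X * ‖v‖ ^ 2 - bq k i X ≤ ((𝔊 k i X).q o p v).re))
    {k : ℕ} {g : ℕ → ℝ} (hg : g ∈ W) {U : C.BgB} {o : Op} {hc : ℂ → B13HistM P} {μ₁ R₀ : ℝ}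
    (hcurve : DifferentiableOn ℂ hc (ball (0 : ℂ) μ₁))
    (hK : ∀ s ∈ ball (0 : ℂ) μ₁, (o, hc s) ∈ ballClass ctr ROp RHist k g U) (hR : ∀ s ∈ ball (0 : ℂ) μ₁, ‖hc s‖ ≤ R₀)
    {emb : (tsys 4 N).Dom → C.Dom} (hscale : ∀ Z, C.scale (emb Z) = k) {terms : (tsys 4 N).Dom → Finset ι}
    {act : ℂ → (tsys 4 N).Dom → ℂ}
    (hact : ∀ s ∈ ball (0 : ℂ) μ₁, ∀ Z, act s Z = ∑ i ∈ terms Z, termBi 𝔊 k i o (hc s) (emb Z))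
    {A R r₁ μ₀ : ℝ} (X₀ : (tsys 4 N).Dom) {sμ : ℂ} (hA : 0 ≤ A) (hr₁ : 0 ≤ r₁)
    (hrate : r₁ + 2 * (64 * Real.log 162) + 2 ≤ R) (hsmall : A * Real.exp (5 * r₁ + 1) * K₀ 64 8 * 9 * 64 ≤ 1)
    (hL3 : ∀ Z : (tsys 4 N).Dom, Z.1 ⊆ X₀.1 →
      ∑ i ∈ terms Z, (∫ z, ‖(𝔊 k i (emb Z)).w z.1 * (𝔊 k i (emb Z)).N o z.1 *
          ((𝔊 k i (emb Z)).chi z.2 * cexp (-(𝔊 k i (emb Z)).q o z.1 z.2))‖ ∂((𝔊 k i (emb Z)).lam.prod volume)) *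
        Real.exp ((𝔊 k i (emb Z)).N₁ * R₀) ≤ A * Real.exp (-(R * torusTreeLen Z.1)))
    (h0 : 0 < μ₀) (h01 : μ₀ < μ₁) (hμ : ‖sμ‖ ≤ μ₀) :
    ‖locE (TTouch (d := 4) (N := N)) (fun Z : (tsys 4 N).Dom => Z.1) (act sμ) X₀.1 -
        locE (TTouch (d := 4) (N := N)) (fun Z : (tsys 4 N).Dom => Z.1) (act 0) X₀.1‖ ≤
      Real.exp 1 * 9 * 64 * K₀ 64 8 ^ 2 * A * Real.exp (-(r₁ * torusTreeLen X₀.1)) * (μ₀ / (μ₁ - μ₀)) := by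
  obtain ⟨hν, hκ, hc⟩ := torus_consts N
  have hK₀ := K₀_four (N := N)
  have h := muPart_locE_le_of_cores (tsys 4 N) (tgeometry 4 N) 𝔊 hroom hm hN hq hg hcurve hK hR hscale hact (R := R)
    (b₅ := 5 * r₁) (X₀ := X₀) (sμ := sμ) hA hr₁ (le_of_eq (by ring)) (by rw [hκ]; exact hrate)
    (by rw [hK₀, hν, hc]; exact hsmall) hL3 h0 h01 hμ
  rw [hν, hc, hK₀] at h
  exact h

open Classical in
/-- **THE μ-PART ON CORES ON THE TORUS, (B3) AS A LETTER BUDGET — NO GEOMETRY HYPOTHESIS** (kernel; N0q §3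
`muPart_locE_le_of_cores_mass` at `tgeometry 4 N`, constants located; `hL3 ↦ hM3` on the cores' scalar letters). [folklore] -/
theorem muPart_locE_le_of_cores_mass_torus {W : Set (ℕ → ℝ)} {ctr : ℕ → (ℕ → ℝ) → C.BgB → Op × B13HistM P}
    {ROp RHist R' : ℕ → ℝ} (𝔊 : ∀ k i, C.Dom → BiCore P dom Op (β k i) (α k i)) {mq bq N₀ : ℕ → ι → C.Dom → ℝ}
    (hroom : ∀ k, ROp k < R' k)
    (hm : ∀ k, ∀ g ∈ W, ∀ (U : C.BgB) (X : C.Dom), C.scale X = k → ∀ i, 0 < mq k i X)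
    (hN : ∀ k, ∀ g ∈ W, ∀ (U : C.BgB) (X : C.Dom), C.scale X = k → ∀ i,
      (∀ o ∈ ball (ctr k g U).1 (R' k), AEStronglyMeasurable ((𝔊 k i X).N o) (𝔊 k i X).lam) ∧
      (∀ p, DifferentiableOn ℂ (fun o => (𝔊 k i X).N o p) (ball (ctr k g U).1 (R' k))) ∧
      (∀ o ∈ ball (ctr k g U).1 (R' k), ∀ p, ‖(𝔊 k i X).N o p‖ ≤ N₀ k i X))
    (hq : ∀ k, ∀ g ∈ W, ∀ (U : C.BgB) (X : C.Dom), C.scale X = k → ∀ i,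
      (∀ o ∈ ball (ctr k g U).1 (R' k),
        AEStronglyMeasurable (Function.uncurry ((𝔊 k i X).q o)) ((𝔊 k i X).lam.prod volume)) ∧
      (∀ p v, DifferentiableOn ℂ (fun o => (𝔊 k i X).q o p v) (ball (ctr k g U).1 (R' k))) ∧
      (∀ o ∈ ball (ctr k g U).1 (R' k), ∀ p v, mq k i X * ‖v‖ ^ 2 - bq k i X ≤ ((𝔊 k i X).q o p v).re))
    {k : ℕ} {g : ℕ → ℝ} (hg : g ∈ W) {U : C.BgB} {o : Op} {hc : ℂ → B13HistM P} {μ₁ R₀ : ℝ}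
    (hcurve : DifferentiableOn ℂ hc (ball (0 : ℂ) μ₁))
    (hK : ∀ s ∈ ball (0 : ℂ) μ₁, (o, hc s) ∈ ballClass ctr ROp RHist k g U) (hR : ∀ s ∈ ball (0 : ℂ) μ₁, ‖hc s‖ ≤ R₀)
    {emb : (tsys 4 N).Dom → C.Dom} (hscale : ∀ Z, C.scale (emb Z) = k) {terms : (tsys 4 N).Dom → Finset ι}
    {act : ℂ → (tsys 4 N).Dom → ℂ}
    (hact : ∀ s ∈ ball (0 : ℂ) μ₁, ∀ Z, act s Z = ∑ i ∈ terms Z, termBi 𝔊 k i o (hc s) (emb Z))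
    {A R r₁ μ₀ : ℝ} (X₀ : (tsys 4 N).Dom) {sμ : ℂ} (hA : 0 ≤ A) (hr₁ : 0 ≤ r₁)
    (hrate : r₁ + 2 * (64 * Real.log 162) + 2 ≤ R) (hsmall : A * Real.exp (5 * r₁ + 1) * K₀ 64 8 * 9 * 64 ≤ 1)
    (hM3 : ∀ Z : (tsys 4 N).Dom, Z.1 ⊆ X₀.1 →
      ∑ i ∈ terms Z, (𝔊 k i (emb Z)).lam.real univ * ((𝔊 k i (emb Z)).wB * N₀ k i (emb Z) *
          Real.exp (bq k i (emb Z))) * (Real.pi / (mq k i (emb Z) / 2)) ^ (Module.finrank ℝ (α k i) / 2 : ℝ) *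
        Real.exp ((𝔊 k i (emb Z)).N₁ * R₀) ≤ A * Real.exp (-(R * torusTreeLen Z.1)))
    (h0 : 0 < μ₀) (h01 : μ₀ < μ₁) (hμ : ‖sμ‖ ≤ μ₀) :
    ‖locE (TTouch (d := 4) (N := N)) (fun Z : (tsys 4 N).Dom => Z.1) (act sμ) X₀.1 -
        locE (TTouch (d := 4) (N := N)) (fun Z : (tsys 4 N).Dom => Z.1) (act 0) X₀.1‖ ≤
      Real.exp 1 * 9 * 64 * K₀ 64 8 ^ 2 * A * Real.exp (-(r₁ * torusTreeLen X₀.1)) * (μ₀ / (μ₁ - μ₀)) := by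
  obtain ⟨hν, hκ, hc⟩ := torus_consts N
  have hK₀ := K₀_four (N := N)
  have h := muPart_locE_le_of_cores_mass (tsys 4 N) (tgeometry 4 N) 𝔊 hroom hm hN hq hg hcurve hK hR hscale hact (R := R)
    (b₅ := 5 * r₁) (X₀ := X₀) (sμ := sμ) hA hr₁ (le_of_eq (by ring)) (by rw [hκ]; exact hrate)
    (by rw [hK₀, hν, hc]; exact hsmall) hM3 h0 h01 hμ
  rw [hν, hc, hK₀] at h
  exact h

/-! ## §3 Consistency — THE COMMUTING SQUARE, in kernel: (torus ∘ letters) = (letters ∘ torus) -/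

open Classical in
/-- §2's `attachedPart_locE_le_of_cores_pencil_mass_torus` IS S27's `attachedPart_locE_le_of_cores_pencil_torus` (N0p's pencil END on
the torus, `hL3` on the parameter-mass INTEGRALS) with `hL3` fed from the letter budget `hM3` by N0q §2 `sum_coreMass_le_sum_letters`
BY NAME — the square «N0p → N0q (letters), N0p → S27 (torus)» commutes; this file asserts NO new inequality. [folklore] -/
example {W : Set (ℕ → ℝ)}
    {ctr : ℕ → (ℕ → ℝ) → C.BgB → Op × B13HistM P} {ROp RHist R' : ℕ → ℝ}
    (𝔊 : ∀ k i, C.Dom → BiCore P dom Op (β k i) (α k i)) {mq bq N₀ : ℕ → ι → C.Dom → ℝ} (hroom : ∀ k, ROp k < R' k)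
    (hm : ∀ k, ∀ g ∈ W, ∀ (U : C.BgB) (X : C.Dom), C.scale X = k → ∀ i, 0 < mq k i X)
    (hN : ∀ k, ∀ g ∈ W, ∀ (U : C.BgB) (X : C.Dom), C.scale X = k → ∀ i,
      (∀ o ∈ ball (ctr k g U).1 (R' k), AEStronglyMeasurable ((𝔊 k i X).N o) (𝔊 k i X).lam) ∧
      (∀ p, DifferentiableOn ℂ (fun o => (𝔊 k i X).N o p) (ball (ctr k g U).1 (R' k))) ∧
      (∀ o ∈ ball (ctr k g U).1 (R' k), ∀ p, ‖(𝔊 k i X).N o p‖ ≤ N₀ k i X))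
    (hq : ∀ k, ∀ g ∈ W, ∀ (U : C.BgB) (X : C.Dom), C.scale X = k → ∀ i,
      (∀ o ∈ ball (ctr k g U).1 (R' k),
        AEStronglyMeasurable (Function.uncurry ((𝔊 k i X).q o)) ((𝔊 k i X).lam.prod volume)) ∧
      (∀ p v, DifferentiableOn ℂ (fun o => (𝔊 k i X).q o p v) (ball (ctr k g U).1 (R' k))) ∧
      (∀ o ∈ ball (ctr k g U).1 (R' k), ∀ p v, mq k i X * ‖v‖ ^ 2 - bq k i X ≤ ((𝔊 k i X).q o p v).re))
    {k : ℕ} {g : ℕ → ℝ} (hg : g ∈ W) {U : C.BgB} {o : Op} {h₀ w : B13HistM P} {ϱ : ℝ}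
    (hO : ‖o - (ctr k g U).1‖ ≤ ROp k) (hH : ‖h₀ - (ctr k g U).2‖ + ϱ * ‖w‖ ≤ RHist k)
    {emb : (tsys 4 N).Dom → C.Dom} (hscale : ∀ Z, C.scale (emb Z) = k) {terms : (tsys 4 N).Dom → Finset ι}
    {act : ℂ → (tsys 4 N).Dom → ℂ}
    (hact : ∀ s ∈ ball (0 : ℂ) ϱ, ∀ Z, act s Z = ∑ i ∈ terms Z, termBi 𝔊 k i o (h₀ + s • w) (emb Z))
    {A₀ A₁ R r₁ : ℝ} (X₀ : (tsys 4 N).Dom) (hA₀ : 0 ≤ A₀) (hA₁ : 0 ≤ A₁) (hr₁ : 0 ≤ r₁)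
    (hrate : r₁ + 2 * (64 * Real.log 162) + 2 ≤ R)
    (hsmall : (A₀ + ϱ * A₁) * Real.exp (5 * r₁ + 1) * K₀ 64 8 * 9 * 64 ≤ 1)
    (hM3 : ∀ Z : (tsys 4 N).Dom, Z.1 ⊆ X₀.1 →
      ∑ i ∈ terms Z, (𝔊 k i (emb Z)).lam.real univ * ((𝔊 k i (emb Z)).wB * N₀ k i (emb Z) *
          Real.exp (bq k i (emb Z))) * (Real.pi / (mq k i (emb Z) / 2)) ^ (Module.finrank ℝ (α k i) / 2 : ℝ) *
        Real.exp ((𝔊 k i (emb Z)).N₁ * (‖h₀‖ + ϱ * ‖w‖)) ≤ (A₀ + ϱ * A₁) * Real.exp (-(R * torusTreeLen Z.1)))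
    (hϱ : 2 ≤ ϱ) (hϱA : A₀ ≤ ϱ * A₁) :
    ‖locE (TTouch (d := 4) (N := N)) (fun Z : (tsys 4 N).Dom => Z.1) (act 1) X₀.1 -
        locE (TTouch (d := 4) (N := N)) (fun Z : (tsys 4 N).Dom => Z.1) (act 0) X₀.1‖ ≤
      4 * (Real.exp 1 * 9 * 64 * K₀ 64 8 ^ 2) * A₁ * Real.exp (-(r₁ * torusTreeLen X₀.1)) := by
  have ho : o ∈ ball (ctr k g U).1 (R' k) := mem_ball.2 (by rw [dist_eq_norm]; exact lt_of_le_of_lt hO (hroom k))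
  refine attachedPart_locE_le_of_cores_pencil_torus 𝔊 hroom hm hN hq hg hO hH hscale hact X₀ hA₀ hA₁ hr₁ hrate hsmall
    (fun Z hZ => le_trans ?_ (hM3 Z hZ)) hϱ hϱA
  simpa only [one_mul] using sum_coreMass_le_sum_letters 𝔊 hm (fun k g hg U X hX i => (hN k g hg U X hX i).2.2)
    (fun k g hg U X hX i => (hq k g hg U X hX i).2.2) hg ho hscale terms (‖h₀‖ + ϱ * ‖w‖) Z

end Torus

end Summit.QuantumFields.BalabanUV.T4Continuum.NE1p.DressedSmallFieldOnCoresMassFaces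

end
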